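/-
Copyright (c) 2026 the pub-hodgecm-mathlib formalisation cell (harness21).  Prover seat hodgecm-mathlib-B-p04 (g48): LH4-plan (g6) WORD #124 «GO, STAGED», ENGINE′ layer (L3′)
= the EISENSTEIN twin of ★ [T2-c] layer 3 `QuadraticRamifiedOrderNormIndex` (A-p19 p846601); 2026-09-02.
-/
import Literature.NumberTheory.Automorphic.QuadraticEisensteinOrderMonogenic   -- (L2′) p851856 (this seat): index, conductor, locality of `𝒪[(u, jp + jqθ)]`; brings (L1′) p851849
import Literature.NumberTheory.Automorphic.QuadraticRamifiedOrderNormIndex    -- ★ p846601 (A-p19): θ-shape-free parts reused BY NAME: `map_k₀_mem_maximalIdeal`, `star_involutive`, `range_norm_eq`, `exists_coord_fixed`, `comp_mem_eqLocus`, `mem_eqLocus_prodMap_iff`, `prodMap_subtype_injective`; brings ★ `InvolutionDescentUnitIndex`, ★ O8a-5E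
import HarnessLib

/-!
# The type-(2) unit index, EISENSTEIN shape: `[C : R^×] = (q + 1) · q^{N+n−1}` for `R = 𝒪_E[(u, λ)] ≤ 𝒪_E × O₁`, `O₁ = j𝒪_E ⊕ j𝒪_Eθ`, `θ² = jaθ + jk₀`, `λ = jp + jqθ`

Topic `NumberTheory/Automorphic`; namespace `Literature.NumberTheory.Automorphic`.  THEOREMS ONLY (no definition, no instance, no notation, no named fact, no `sorry`); (D0) currency with
TWO valued fields `F → E` (the inert dictionary: `ιO : 𝒪[F] →+* 𝒪[E]`, involution `σO` of `𝒪[E]` with fixed ring `ιO 𝒪[F]`, `q_E = q_F²`, unit norms onto) and the ABSTRACT quadratic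
ring `O₁ = j𝒪_E ⊕ j𝒪_E θ` of (L1′) `QuadraticEisensteinOrderUnitIndex` with **`θ² = j(ιO a)·θ + j(ιO k₀)`, `a, k₀ ∈ 𝔪_F`** (Eisenstein, coefficients `F`-RATIONAL) and an involution `σ₁`
over `σO` fixing `θ`.  Cell `pub/hodgecm-mathlib` (D-0151), crux H413 = `stmt-HodgeConjecture-24833`; LH4-plan (g6) price list, B-p04 (g47) memo `MEMO-M4-wild-parity.v1` (4adf46b3) **§4
(c)-CONSUMER row «`TypeTwoUnitIndexAtPlace` at a wild unit row», level `N′ = N + k − ord_v 2`** (census B-p04 (g48) 959b1194): ENGINE′ = (L1′) p851849, (L2′) p851856, (L3′) THIS FILE,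
then the place head (H′).  Twin of ★ `QuadraticRamifiedOrderNormIndex` with: the generator on general integral coordinates `λ = jp + jqθ` (`hlam`), the quadratic relation `hlam2 :
λ² − tλ + D = 0`, the locality clauses `hu1 hp1 hχ1` of (L2′), and the unitarity of the generator **`hxstar : (u, λ)·(u, λ)⋆ = 1` taken as a BINDER** (at a wild unit-discriminant row it is
the conjunct `λ₁·s̃λ₁ = 1` of ★ `exists_eigenField_package_wildUnit`, not derivable from `4D = t² − y²k₀` inside `𝒪_w` since `e₂ = 1∕2 ∉ 𝒪_w`).  The ★ file (case `a = 0`, `λ = j(e₂t) +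
j(e₂y)θ`) is UNTOUCHED; its θ-shape-free lemmas (`map_k₀_mem_maximalIdeal`, `star_involutive`, `range_norm_eq`, `exists_coord_fixed`, `comp_mem_eqLocus`, `mem_eqLocus_prodMap_iff`,
`prodMap_subtype_injective`) are cited BY NAME.
HONEST LABEL: HC_CM is proved only modulo the 7 printed citations (2 remaining named inputs: hLiu418 = stmt-HodgeConjecture-24832, h413 = stmt-HodgeConjecture-24833) until rung 0
closes; commutative algebra, count-neutral (pays no organ, opens no road).

THE MATHEMATICS (as ★, with `N := ord q`).  `Λ = 𝒪_E × O₁`, `⋆ = (σO, σ₁)`, `R = 𝒪_E[x]`, `x = (u, λ)`, `x·x⋆ = 1` so `x⋆ = x⁻¹ ∈ R` and `R⋆ = R`.  `N(c) = c·c⋆` maps `Λ^×` ONTO `(Λ^⋆)^×` (★),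
`C := N⁻¹(R^×) ≥ R^×`, and ★ `relIndex_comap_norm_mul_relIndex_eq_index` gives `[C : R^×]·[(Λ^⋆)^× : R^{⋆×}] = [Λ^× : R^×] = (q²−1) q^{2(N+n−1)}` ((L2′) at `q_E = q²`).  The fixed ring is
`Λ^⋆ ≅ 𝒪_F × O₁^{σ₁}` with `O₁^{σ₁} = j′𝒪_F ⊕ j′𝒪_F θ` AGAIN EISENSTEIN over `𝒪_F` (`θ² = j′a·θ + j′k₀`), `R^⋆ = R ∩ Λ^⋆` local with residue field `𝓀_F`, `ϖ^{N+n}Λ^⋆ ⊆ R^⋆`, and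
`[Λ^⋆ : R^⋆] = q^{N+n}` by ★ descent `[Λ : R] = [Λ^⋆ : R^⋆]²`; so (L1′) gives `[(Λ^⋆)^× : R^{⋆×}] = (q−1) q^{N+n−1}` and **`[C : R^×] = (q + 1) · q^{N+n−1}`**.

* §1 `star_mem_range_eval₂_eisenstein`; §3 `isLocalRing_comap_fixed_eisenstein`, `natCard_residueField_comap_fixed_eisenstein`, `index_comap_fixed_eq_pow_eisenstein`,
  `index_units_comap_fixed_eq_eisenstein`, `relIndex_units_fixed_eq_eisenstein`; §4 **`relIndex_units_comap_norm_eq_eisenstein`**.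

## References
* [Rogawski1990] J. D. Rogawski, *Automorphic Representations of Unitary Groups in Three Variables* (1990): §4.9 Lemma 4.9.3 p. 56, Prop. 4.9.1 (b) p. 55.
* [SerreLocalFields1979] J.-P. Serre, *Local Fields*, GTM 67 (1979): Ch. V §2 Prop. 3 and Corollary (unit norms at an unramified extension); Ch. I §6 Prop. 17–18; Ch. II §5.
* [Neukirch1999] J. Neukirch, *Algebraic Number Theory*, Grundlehren 322 (1999): Ch. I §12 (orders, conductor, unit indices).
* [Jacobowitz1962] R. Jacobowitz, *Hermitian forms over local fields*, Amer. J. Math. 84 (1962): §7 (lattices of an order as a units-torsor).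
-/

set_option autoImplicit false

noncomputable section

open scoped ValuativeRel
open Polynomial ValuativeRel

namespace Literature.NumberTheory.Automorphic

open Literature.RingTheory.GaloisAlgebras

variable {F E : Type*} [Field F] [ValuativeRel F] [Field E] [ValuativeRel E] {O₁ : Type*} [CommRing O₁]
  (ιO : 𝒪[F] →+* 𝒪[E]) (σO : 𝒪[E] →+* 𝒪[E]) (j : 𝒪[E] →+* O₁) (σ₁ : O₁ →+* O₁) (θ : O₁) {aF k₀F : 𝒪[F]}
  (u : 𝒪[E]) {t D p q : 𝒪[E]} {lam : O₁}

/-! ## §1 `⋆`-stability of `R` from the unitarity binder `x·x⋆ = 1` -/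

/-- **`R⋆ = R`**: `⋆ = (σO, σ₁)` maps `R = 𝒪[x]` into itself, GIVEN `x·x⋆ = 1` (`x⋆ = x⁻¹ ∈ R` by (L2′) `inv_mem_range_eval₂_eisenstein`, constants go to constants, three-term form).
[cite: Rogawski1990, §4.9 p. 55] -/
theorem star_mem_range_eval₂_eisenstein (hιu : ∀ y, IsUnit (ιO y) → IsUnit y) (hσ₁j : ∀ x, σ₁ (j x) = j (σO x))
    (hθ : θ ^ 2 = j (ιO aF) * θ + j (ιO k₀F)) (haF : aF ∈ IsLocalRing.maximalIdeal 𝒪[F]) (hk₀ : k₀F ∈ IsLocalRing.maximalIdeal 𝒪[F])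
    (hcoord : ∀ z : O₁, ∃! bc : 𝒪[E] × 𝒪[E], z = j bc.1 + j bc.2 * θ) (hlam2 : lam ^ 2 - j t * lam + j D = 0)
    (hxstar : ((u, lam) : 𝒪[E] × O₁) * RingHom.prodMap σO σ₁ (u, lam) = 1) {z : 𝒪[E] × O₁}
    (hz : z ∈ (Polynomial.eval₂RingHom (RingHom.prod (RingHom.id 𝒪[E]) j) ((u, lam) : 𝒪[E] × O₁)).range) :
    RingHom.prodMap σO σ₁ z ∈ (Polynomial.eval₂RingHom (RingHom.prod (RingHom.id 𝒪[E]) j) ((u, lam) : 𝒪[E] × O₁)).range := by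
  set R := (Polynomial.eval₂RingHom (RingHom.prod (RingHom.id 𝒪[E]) j) ((u, lam) : 𝒪[E] × O₁)).range with hR
  have ha : ιO aF ∈ IsLocalRing.maximalIdeal 𝒪[E] := map_k₀_mem_maximalIdeal ιO hιu haF
  have hk : ιO k₀F ∈ IsLocalRing.maximalIdeal 𝒪[E] := map_k₀_mem_maximalIdeal ιO hιu hk₀
  -- `x⋆ = x⁻¹ ∈ R`
  have hxu : IsUnit ((u, lam) : 𝒪[E] × O₁) := IsUnit.of_mul_eq_one _ hxstar
  have hxinv : RingHom.prodMap σO σ₁ (u, lam) = ↑hxu.unit⁻¹ := (Units.inv_eq_of_mul_eq_one_right (by rw [IsUnit.unit_spec]; exact hxstar)).symm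
  have hstarx : RingHom.prodMap σO σ₁ (u, lam) ∈ R := by
    rw [hxinv]; exact inv_mem_range_eval₂_eisenstein j θ u hθ ha hk hcoord hxu (gen_mem_range_eval₂ j u)
  -- three-term form
  obtain ⟨c, rfl⟩ := (mem_range_eval₂_iff_eisenstein j u hlam2 z).1 hz
  have hconst : ∀ b : 𝒪[E], RingHom.prodMap σO σ₁ (b, j b) = (σO b, j (σO b)) := fun b => by
    change (σO b, σ₁ (j b)) = _; rw [hσ₁j]
  simp only [map_add, map_mul, map_pow, hconst]
  exact R.add_mem (R.add_mem (const_mem_range_eval₂ j u _) (R.mul_mem (const_mem_range_eval₂ j u _) hstarx))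
    (R.mul_mem (const_mem_range_eval₂ j u _) (R.pow_mem hstarx 2))

/-! ## §3 The fixed side: `R^⋆` local with residue field `𝓀_F`, `[Λ^⋆ : R^⋆] = q^{N+n}`, `[(Λ^⋆)^× : R^{⋆×}] = (q−1)q^{N+n−1}` -/

/-- **`R^⋆ = R ∩ Λ^⋆` (pulled back along `Ψ₀ = (ιO, incl)`) IS LOCAL**, its units being detected by the residue of the first (`𝒪_F`-) coordinate ((L2′) unit criterion and
inverse-closedness). [cite: Neukirch1999, Ch. I §12] -/
theorem isLocalRing_comap_fixed_eisenstein (hσι : ∀ y, σO (ιO y) = ιO y) (hfixO : ∀ x, σO x = x → ∃ y, ιO y = x) (hιinj : Function.Injective ιO)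
    (hιu : ∀ y, IsUnit (ιO y) → IsUnit y)
    (hθ : θ ^ 2 = j (ιO aF) * θ + j (ιO k₀F)) (haF : aF ∈ IsLocalRing.maximalIdeal 𝒪[F]) (hk₀ : k₀F ∈ IsLocalRing.maximalIdeal 𝒪[F])
    (hcoord : ∀ z : O₁, ∃! bc : 𝒪[E] × 𝒪[E], z = j bc.1 + j bc.2 * θ) (hlam : lam = j p + j q * θ) (hlam2 : lam ^ 2 - j t * lam + j D = 0)
    (hu1 : u - 1 ∈ IsLocalRing.maximalIdeal 𝒪[E]) (hp1 : p - 1 ∈ IsLocalRing.maximalIdeal 𝒪[E]) (hχ1 : 1 - t + D ∈ IsLocalRing.maximalIdeal 𝒪[E]) :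
    IsLocalRing ((Polynomial.eval₂RingHom (RingHom.prod (RingHom.id 𝒪[E]) j) ((u, lam) : 𝒪[E] × O₁)).range.comap
      (RingHom.prodMap ιO (RingHom.eqLocus σ₁ (RingHom.id O₁)).subtype)) ∧
    ∀ r : (Polynomial.eval₂RingHom (RingHom.prod (RingHom.id 𝒪[E]) j) ((u, lam) : 𝒪[E] × O₁)).range.comap
      (RingHom.prodMap ιO (RingHom.eqLocus σ₁ (RingHom.id O₁)).subtype), IsUnit r ↔ IsUnit (r : 𝒪[F] × RingHom.eqLocus σ₁ (RingHom.id O₁)).1 := by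
  set R := (Polynomial.eval₂RingHom (RingHom.prod (RingHom.id 𝒪[E]) j) ((u, lam) : 𝒪[E] × O₁)).range with hR
  set Ψ₀ := RingHom.prodMap ιO (RingHom.eqLocus σ₁ (RingHom.id O₁)).subtype with hΨ₀
  set R₀ := R.comap Ψ₀ with hR₀
  have ha : ιO aF ∈ IsLocalRing.maximalIdeal 𝒪[E] := map_k₀_mem_maximalIdeal ιO hιu haF
  have hk : ιO k₀F ∈ IsLocalRing.maximalIdeal 𝒪[E] := map_k₀_mem_maximalIdeal ιO hιu hk₀
  have hunit : ∀ r : R₀, IsUnit r ↔ IsUnit (r : 𝒪[F] × RingHom.eqLocus σ₁ (RingHom.id O₁)).1 := by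
    intro r
    constructor
    · intro h
      exact (Prod.isUnit_iff.1 ((h.map R₀.subtype))).1
    · intro h1
      have hmem : Ψ₀ (r : 𝒪[F] × _) ∈ R := r.2
      have hfst : IsUnit (Ψ₀ (r : 𝒪[F] × _)).1 := h1.map ιO
      have hzu : IsUnit (Ψ₀ (r : 𝒪[F] × _)) :=
        (isUnit_iff_isUnit_fst_of_mem_range_eisenstein j θ u hθ ha hk hcoord hlam hlam2 hu1 hp1 hχ1 hmem).2 hfst
      have hinv := inv_mem_range_eval₂_eisenstein j θ u hθ ha hk hcoord hzu hmem
      -- the inverse is fixed, hence in the range of `Ψ₀`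
      have hfixz : RingHom.prodMap σO σ₁ (Ψ₀ (r : 𝒪[F] × _)) = Ψ₀ (r : 𝒪[F] × _) :=
        (mem_eqLocus_prodMap_iff ιO σO σ₁ hσι hfixO _).2 ⟨_, rfl⟩
      have hfixinv : RingHom.prodMap σO σ₁ (↑hzu.unit⁻¹ : 𝒪[E] × O₁) = ↑hzu.unit⁻¹ := by
        have h := congrArg (RingHom.prodMap σO σ₁) hzu.unit.inv_mul
        rw [map_mul, map_one, IsUnit.unit_spec, hfixz] at h
        have h' : RingHom.prodMap σO σ₁ (↑hzu.unit⁻¹ : 𝒪[E] × O₁) * (hzu.unit : 𝒪[E] × O₁) = 1 := by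
          rw [IsUnit.unit_spec]; exact h
        exact (Units.inv_eq_of_mul_eq_one_left h').symm
      obtain ⟨s, hs⟩ := (mem_eqLocus_prodMap_iff ιO σO σ₁ hσι hfixO _).1 (RingHom.mem_eqLocus.2 hfixinv)
      have hsR : s ∈ R₀ := by
        change Ψ₀ s ∈ R; rw [hs]; exact hinv
      refine IsUnit.of_mul_eq_one ⟨s, hsR⟩ (Subtype.ext (prodMap_subtype_injective ιO σ₁ hιinj ?_))
      change Ψ₀ ((r : 𝒪[F] × _) * s) = Ψ₀ 1
      rw [map_mul, map_one, hs, IsUnit.mul_val_inv]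
  refine ⟨?_, hunit⟩
  haveI : Nontrivial R₀ := by
    refine ⟨⟨0, 1, fun h => ?_⟩⟩
    have := congrArg (fun r : R₀ => (r : 𝒪[F] × RingHom.eqLocus σ₁ (RingHom.id O₁)).1) h
    simp at this
  refine IsLocalRing.of_nonunits_add ?_
  intro r s hr hs
  rw [mem_nonunits_iff, hunit] at hr hs ⊢
  rw [Subring.coe_add, Prod.fst_add]
  intro hrs
  have hrm : (r : 𝒪[F] × RingHom.eqLocus σ₁ (RingHom.id O₁)).1 ∈ IsLocalRing.maximalIdeal 𝒪[F] :=
    (IsLocalRing.mem_maximalIdeal ((r : 𝒪[F] × RingHom.eqLocus σ₁ (RingHom.id O₁)).1)).2 hr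
  have hsm : (s : 𝒪[F] × RingHom.eqLocus σ₁ (RingHom.id O₁)).1 ∈ IsLocalRing.maximalIdeal 𝒪[F] :=
    (IsLocalRing.mem_maximalIdeal ((s : 𝒪[F] × RingHom.eqLocus σ₁ (RingHom.id O₁)).1)).2 hs
  exact (IsLocalRing.mem_maximalIdeal _ |>.1 (Ideal.add_mem _ hrm hsm)) hrs

/-- **THE RESIDUE FIELD OF `R^⋆` IS `𝓀_F`**: `#k_{R^⋆} = q`. [cite: Neukirch1999, Ch. I §12] -/
theorem natCard_residueField_comap_fixed_eisenstein (hσι : ∀ y, σO (ιO y) = ιO y)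
    (hfixO : ∀ x, σO x = x → ∃ y, ιO y = x) (hιinj : Function.Injective ιO) (hιu : ∀ y, IsUnit (ιO y) → IsUnit y)
    (hσ₁j : ∀ x, σ₁ (j x) = j (σO x)) (hσ₁θ : σ₁ θ = θ)
    (hθ : θ ^ 2 = j (ιO aF) * θ + j (ιO k₀F)) (haF : aF ∈ IsLocalRing.maximalIdeal 𝒪[F]) (hk₀ : k₀F ∈ IsLocalRing.maximalIdeal 𝒪[F])
    (hcoord : ∀ z : O₁, ∃! bc : 𝒪[E] × 𝒪[E], z = j bc.1 + j bc.2 * θ) (hlam : lam = j p + j q * θ) (hlam2 : lam ^ 2 - j t * lam + j D = 0)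
    (hu1 : u - 1 ∈ IsLocalRing.maximalIdeal 𝒪[E]) (hp1 : p - 1 ∈ IsLocalRing.maximalIdeal 𝒪[E]) (hχ1 : 1 - t + D ∈ IsLocalRing.maximalIdeal 𝒪[E]) :
    @Nat.card (@IsLocalRing.ResidueField ((Polynomial.eval₂RingHom (RingHom.prod (RingHom.id 𝒪[E]) j) ((u, lam) : 𝒪[E] × O₁)).range.comap
      (RingHom.prodMap ιO (RingHom.eqLocus σ₁ (RingHom.id O₁)).subtype)) _
      (isLocalRing_comap_fixed_eisenstein ιO σO j σ₁ θ u hσι hfixO hιinj hιu hθ haF hk₀ hcoord hlam hlam2 hu1 hp1 hχ1).1) = Nat.card 𝓀[F] := by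
  set R := (Polynomial.eval₂RingHom (RingHom.prod (RingHom.id 𝒪[E]) j) ((u, lam) : 𝒪[E] × O₁)).range with hR
  set Ψ₀ := RingHom.prodMap ιO (RingHom.eqLocus σ₁ (RingHom.id O₁)).subtype with hΨ₀
  set R₀ := R.comap Ψ₀ with hR₀
  obtain ⟨hloc, hunit⟩ := isLocalRing_comap_fixed_eisenstein ιO σO j σ₁ θ u hσι hfixO hιinj hιu hθ haF hk₀ hcoord hlam hlam2 hu1 hp1 hχ1
  letI := hloc
  obtain ⟨hj', -⟩ := comp_mem_eqLocus ιO σO j σ₁ θ hσι hσ₁j hσ₁θ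
  set χ : R₀ →+* 𝓀[F] := (IsLocalRing.residue 𝒪[F]).comp ((RingHom.fst 𝒪[F] (RingHom.eqLocus σ₁ (RingHom.id O₁))).comp R₀.subtype) with hχ
  have hχapp : ∀ r : R₀, χ r = IsLocalRing.residue 𝒪[F] (r : 𝒪[F] × RingHom.eqLocus σ₁ (RingHom.id O₁)).1 := fun _ => rfl
  have hsurj : Function.Surjective χ := by
    intro x
    obtain ⟨c, rfl⟩ := IsLocalRing.residue_surjective x
    have hmem : ((c, ((j.comp ιO).codRestrict (RingHom.eqLocus σ₁ (RingHom.id O₁)) hj') c) : 𝒪[F] × RingHom.eqLocus σ₁ (RingHom.id O₁)) ∈ R₀ := by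
      change Ψ₀ _ ∈ R
      exact const_mem_range_eval₂ j u (ιO c)
    exact ⟨⟨_, hmem⟩, rfl⟩
  have hker : RingHom.ker χ = IsLocalRing.maximalIdeal R₀ := by
    ext r
    rw [RingHom.mem_ker, hχapp, IsLocalRing.residue_eq_zero_iff, IsLocalRing.mem_maximalIdeal, IsLocalRing.mem_maximalIdeal, mem_nonunits_iff,
      mem_nonunits_iff, hunit]
  unfold IsLocalRing.ResidueField
  rw [← hker]
  exact Nat.card_congr (RingHom.quotientKerEquivOfSurjective hsurj).toEquiv

variable {ϖF : F} {ϖ : E} {n N : ℕ} {ξ : 𝒪[E]}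

/-- **`[Λ^⋆ : R^⋆] = q^{N+n}`** (`N = ord q` the order of the `θ`-coordinate of `λ`): ★ descent `[Λ : R] = [Λ^⋆ : R^⋆]²` along `ξΛ = (ξ, jξ)` with `[Λ : R] = q_E^{N+n} = q^{2(N+n)}` ((L2′)).
[cite: Neukirch1999, Ch. I §12] -/
theorem index_comap_fixed_eq_pow_eisenstein [IsDiscreteValuationRing 𝒪[E]] (hσσ : ∀ x, σO (σO x) = x) (hσι : ∀ y, σO (ιO y) = ιO y)
    (hfixO : ∀ x, σO x = x → ∃ y, ιO y = x) (hιu : ∀ y, IsUnit (ιO y) → IsUnit y) (hσ₁j : ∀ x, σ₁ (j x) = j (σO x)) (hσ₁θ : σ₁ θ = θ)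
    (hθ : θ ^ 2 = j (ιO aF) * θ + j (ιO k₀F)) (haF : aF ∈ IsLocalRing.maximalIdeal 𝒪[F]) (hk₀ : k₀F ∈ IsLocalRing.maximalIdeal 𝒪[F])
    (hcoord : ∀ z : O₁, ∃! bc : 𝒪[E] × 𝒪[E], z = j bc.1 + j bc.2 * θ) (hlam : lam = j p + j q * θ) (hlam2 : lam ^ 2 - j t * lam + j D = 0)
    (hxstar : ((u, lam) : 𝒪[E] × O₁) * RingHom.prodMap σO σ₁ (u, lam) = 1)
    (hϖ : IsUniformizingElement ϖ) (hn : valuation E ((u * u - t * u + D : 𝒪[E]) : E) = valuation E ϖ ^ n) (hN : valuation E ((q : 𝒪[E]) : E) = valuation E ϖ ^ N)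
    (hq : Nat.card 𝓀[E] = Nat.card 𝓀[F] ^ 2) (hξ : IsUnit (ξ - σO ξ)) :
    ((Polynomial.eval₂RingHom (RingHom.prod (RingHom.id 𝒪[E]) j) ((u, lam) : 𝒪[E] × O₁)).range.comap
      (RingHom.prodMap ιO (RingHom.eqLocus σ₁ (RingHom.id O₁)).subtype)).toAddSubgroup.index = Nat.card 𝓀[F] ^ (N + n) := by
  set R := (Polynomial.eval₂RingHom (RingHom.prod (RingHom.id 𝒪[E]) j) ((u, lam) : 𝒪[E] × O₁)).range with hR
  set Ψ₀ := RingHom.prodMap ιO (RingHom.eqLocus σ₁ (RingHom.id O₁)).subtype with hΨ₀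
  set B₀ := RingHom.eqLocus (RingHom.prodMap σO σ₁) (RingHom.id (𝒪[E] × O₁)) with hB₀
  -- `[Λ : R] = q^{2(N+n)}`
  have hidx := index_range_eval₂_eq_pow_eisenstein j θ u hcoord hlam hlam2 hϖ hn hN
  rw [hq, ← pow_mul] at hidx
  -- descent along `ξΛ = (ξ, jξ)`
  obtain ⟨ε, hε⟩ := hξ
  have hstar := star_involutive σO j σ₁ θ hσσ hσ₁j hσ₁θ hcoord
  have he : ((↑ε⁻¹, j ↑ε⁻¹) : 𝒪[E] × O₁) * (((ξ, j ξ) : 𝒪[E] × O₁) - RingHom.prodMap σO σ₁ (ξ, j ξ)) = 1 := by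
    change ((↑ε⁻¹, j ↑ε⁻¹) : 𝒪[E] × O₁) * ((ξ, j ξ) - (σO ξ, σ₁ (j ξ))) = 1
    rw [hσ₁j, Prod.mk_sub_mk, ← map_sub, Prod.mk_mul_mk, ← map_mul, ← hε, Units.inv_mul, map_one]; rfl
  have hsR : ∀ z ∈ R, RingHom.prodMap σO σ₁ z ∈ R := fun z hz =>
    star_mem_range_eval₂_eisenstein ιO σO j σ₁ θ u hιu hσ₁j hθ haF hk₀ hcoord hlam2 hxstar hz
  have hdesc := index_eq_relIndex_eqLocus_sq (RingHom.prodMap σO σ₁) hstar he R hsR (const_mem_range_eval₂ j u ξ) (const_mem_range_eval₂ j u _)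
  rw [hidx] at hdesc
  -- `R^⋆` pulled back along `Ψ₀` has index `[Λ^⋆ : R ∩ Λ^⋆]`
  have hrange : Ψ₀.toAddMonoidHom.range = B₀.toAddSubgroup := by
    ext z
    rw [AddMonoidHom.mem_range, Subring.mem_toAddSubgroup, hB₀, mem_eqLocus_prodMap_iff ιO σO σ₁ hσι hfixO]
    rfl
  have hcomap : (R.comap Ψ₀).toAddSubgroup = R.toAddSubgroup.comap Ψ₀.toAddMonoidHom := rfl
  rw [hcomap, AddSubgroup.index_comap, hrange]
  have h2' : Nat.card 𝓀[F] ^ (2 * (N + n)) = (Nat.card 𝓀[F] ^ (N + n)) ^ 2 := by rw [← pow_mul, mul_comm]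
  rw [h2'] at hdesc
  exact Nat.pow_left_injective two_ne_zero hdesc.symm

/-- **`[(Λ^⋆)^× : R^{⋆×}] = (q − 1) · q^{N+n−1}`** ((L1′) `index_range_units_map_prod_mul_eq_eisenstein` on the fixed-side model `𝒪_F × O₁^{σ₁}`, which is again Eisenstein:
`θ² = j′a·θ + j′k₀` with `a, k₀ ∈ 𝔪_F`). [cite: Neukirch1999, Ch. I §12] -/
theorem index_units_comap_fixed_eq_eisenstein [Finite 𝓀[F]] [IsDiscreteValuationRing 𝒪[E]] (hσσ : ∀ x, σO (σO x) = x) (hσι : ∀ y, σO (ιO y) = ιO y)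
    (hfixO : ∀ x, σO x = x → ∃ y, ιO y = x) (hιinj : Function.Injective ιO) (hιu : ∀ y, IsUnit (ιO y) → IsUnit y)
    (hσ₁j : ∀ x, σ₁ (j x) = j (σO x)) (hσ₁θ : σ₁ θ = θ)
    (hθ : θ ^ 2 = j (ιO aF) * θ + j (ιO k₀F)) (haF : aF ∈ IsLocalRing.maximalIdeal 𝒪[F]) (hk₀ : k₀F ∈ IsLocalRing.maximalIdeal 𝒪[F])
    (hcoord : ∀ z : O₁, ∃! bc : 𝒪[E] × 𝒪[E], z = j bc.1 + j bc.2 * θ) (hlam : lam = j p + j q * θ) (hlam2 : lam ^ 2 - j t * lam + j D = 0)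
    (hu1 : u - 1 ∈ IsLocalRing.maximalIdeal 𝒪[E]) (hp1 : p - 1 ∈ IsLocalRing.maximalIdeal 𝒪[E]) (hχ1 : 1 - t + D ∈ IsLocalRing.maximalIdeal 𝒪[E])
    (hxstar : ((u, lam) : 𝒪[E] × O₁) * RingHom.prodMap σO σ₁ (u, lam) = 1)
    (hϖF : IsUniformizingElement ϖF) (hϖ : IsUniformizingElement ϖ) (hιϖ : ιO ⟨ϖF, hϖF.mem⟩ = ⟨ϖ, hϖ.mem⟩)
    (hn : valuation E ((u * u - t * u + D : 𝒪[E]) : E) = valuation E ϖ ^ n) (hN : valuation E ((q : 𝒪[E]) : E) = valuation E ϖ ^ N)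
    (hq : Nat.card 𝓀[E] = Nat.card 𝓀[F] ^ 2) (hξ : IsUnit (ξ - σO ξ)) (hNn : 1 ≤ N + n) :
    (Units.map (((Polynomial.eval₂RingHom (RingHom.prod (RingHom.id 𝒪[E]) j) ((u, lam) : 𝒪[E] × O₁)).range.comap
      (RingHom.prodMap ιO (RingHom.eqLocus σ₁ (RingHom.id O₁)).subtype)).subtype :
        ((Polynomial.eval₂RingHom (RingHom.prod (RingHom.id 𝒪[E]) j) ((u, lam) : 𝒪[E] × O₁)).range.comap
          (RingHom.prodMap ιO (RingHom.eqLocus σ₁ (RingHom.id O₁)).subtype)) →* 𝒪[F] × RingHom.eqLocus σ₁ (RingHom.id O₁))).range.index =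
      (Nat.card 𝓀[F] - 1) * Nat.card 𝓀[F] ^ (N + n - 1) := by
  set R := (Polynomial.eval₂RingHom (RingHom.prod (RingHom.id 𝒪[E]) j) ((u, lam) : 𝒪[E] × O₁)).range with hR
  set Ψ₀ := RingHom.prodMap ιO (RingHom.eqLocus σ₁ (RingHom.id O₁)).subtype with hΨ₀
  set R₀ := R.comap Ψ₀ with hR₀
  obtain ⟨hloc, -⟩ := isLocalRing_comap_fixed_eisenstein ιO σO j σ₁ θ u hσι hfixO hιinj hιu hθ haF hk₀ hcoord hlam hlam2 hu1 hp1 hχ1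
  letI := hloc
  obtain ⟨hj', hθ'⟩ := comp_mem_eqLocus ιO σO j σ₁ θ hσι hσ₁j hσ₁θ
  have hq1 : 1 < Nat.card 𝓀[F] := Finite.one_lt_card
  -- the fixed-side model data (Eisenstein over `𝒪_F`)
  have hθ'' : (⟨θ, hθ'⟩ : RingHom.eqLocus σ₁ (RingHom.id O₁)) ^ 2 =
      ((j.comp ιO).codRestrict (RingHom.eqLocus σ₁ (RingHom.id O₁)) hj') aF * ⟨θ, hθ'⟩ + ((j.comp ιO).codRestrict (RingHom.eqLocus σ₁ (RingHom.id O₁)) hj') k₀F :=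
    Subtype.ext hθ
  have hcoord' := exists_coord_fixed ιO σO j σ₁ θ hfixO hιinj hσ₁j hσ₁θ hcoord hj' hθ'
  have hres := natCard_residueField_comap_fixed_eisenstein ιO σO j σ₁ θ u hσι hfixO hιinj hιu hσ₁j hσ₁θ hθ haF hk₀ hcoord hlam hlam2 hu1 hp1 hχ1
  have hcond : ∀ x : 𝒪[F] × RingHom.eqLocus σ₁ (RingHom.id O₁),
      (((⟨ϖF, hϖF.mem⟩ : 𝒪[F]) ^ (N + n), ((j.comp ιO).codRestrict (RingHom.eqLocus σ₁ (RingHom.id O₁)) hj') ((⟨ϖF, hϖF.mem⟩ : 𝒪[F]) ^ (N + n))) :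
        𝒪[F] × RingHom.eqLocus σ₁ (RingHom.id O₁)) * x ∈ R₀ := by
    intro x
    change Ψ₀ _ ∈ R
    rw [map_mul]
    have hΨ : Ψ₀ (((⟨ϖF, hϖF.mem⟩ : 𝒪[F]) ^ (N + n), ((j.comp ιO).codRestrict (RingHom.eqLocus σ₁ (RingHom.id O₁)) hj') ((⟨ϖF, hϖF.mem⟩ : 𝒪[F]) ^ (N + n))))
        = (((⟨ϖ, hϖ.mem⟩ : 𝒪[E]) ^ (N + n), j ((⟨ϖ, hϖ.mem⟩ : 𝒪[E]) ^ (N + n))) : 𝒪[E] × O₁) := by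
      refine Prod.ext ?_ ?_
      · show ιO ((⟨ϖF, hϖF.mem⟩ : 𝒪[F]) ^ (N + n)) = (⟨ϖ, hϖ.mem⟩ : 𝒪[E]) ^ (N + n)
        rw [map_pow, hιϖ]
      · show ((j.comp ιO) ((⟨ϖF, hϖF.mem⟩ : 𝒪[F]) ^ (N + n)) : O₁) = j ((⟨ϖ, hϖ.mem⟩ : 𝒪[E]) ^ (N + n))
        rw [RingHom.comp_apply, map_pow ιO, hιϖ]
    rw [hΨ]
    exact pow_mul_mem_range_eval₂_eisenstein j θ u hcoord hlam hlam2 hϖ hn hN _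
  have key := index_range_units_map_prod_mul_eq_eisenstein ((j.comp ιO).codRestrict (RingHom.eqLocus σ₁ (RingHom.id O₁)) hj') ⟨θ, hθ'⟩ hθ'' haF hk₀ hcoord' hϖF hNn
    R₀ hres hcond
  rw [index_comap_fixed_eq_pow_eisenstein ιO σO j σ₁ θ u hσσ hσι hfixO hιu hσ₁j hσ₁θ hθ haF hk₀ hcoord hlam hlam2 hxstar hϖ hn hN hq hξ] at key
  have hpow : Nat.card 𝓀[F] ^ (N + n) = Nat.card 𝓀[F] ^ (N + n - 1) * Nat.card 𝓀[F] := by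
    rw [← pow_succ, Nat.sub_add_cancel hNn]
  rw [hpow, ← mul_assoc] at key
  exact Nat.eq_of_mul_eq_mul_right (by omega) key

/-- **`[(Λ^⋆)^× : R^× ∩ (Λ^⋆)^×] = (q − 1) · q^{N+n−1}` INSIDE `Λ^×**`: the fixed units are the image of the units of the fixed-side model under `Ψ₀`, and `R^×` pulls back to `R^{⋆×}`
(Mathlib `Subgroup.index_comap`). [cite: Neukirch1999, Ch. I §12] -/
theorem relIndex_units_fixed_eq_eisenstein [Finite 𝓀[F]] [IsDiscreteValuationRing 𝒪[E]] (hσσ : ∀ x, σO (σO x) = x) (hσι : ∀ y, σO (ιO y) = ιO y)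
    (hfixO : ∀ x, σO x = x → ∃ y, ιO y = x) (hιinj : Function.Injective ιO) (hιu : ∀ y, IsUnit (ιO y) → IsUnit y)
    (hσ₁j : ∀ x, σ₁ (j x) = j (σO x)) (hσ₁θ : σ₁ θ = θ)
    (hθ : θ ^ 2 = j (ιO aF) * θ + j (ιO k₀F)) (haF : aF ∈ IsLocalRing.maximalIdeal 𝒪[F]) (hk₀ : k₀F ∈ IsLocalRing.maximalIdeal 𝒪[F])
    (hcoord : ∀ z : O₁, ∃! bc : 𝒪[E] × 𝒪[E], z = j bc.1 + j bc.2 * θ) (hlam : lam = j p + j q * θ) (hlam2 : lam ^ 2 - j t * lam + j D = 0)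
    (hu1 : u - 1 ∈ IsLocalRing.maximalIdeal 𝒪[E]) (hp1 : p - 1 ∈ IsLocalRing.maximalIdeal 𝒪[E]) (hχ1 : 1 - t + D ∈ IsLocalRing.maximalIdeal 𝒪[E])
    (hxstar : ((u, lam) : 𝒪[E] × O₁) * RingHom.prodMap σO σ₁ (u, lam) = 1)
    (hϖF : IsUniformizingElement ϖF) (hϖ : IsUniformizingElement ϖ) (hιϖ : ιO ⟨ϖF, hϖF.mem⟩ = ⟨ϖ, hϖ.mem⟩)
    (hn : valuation E ((u * u - t * u + D : 𝒪[E]) : E) = valuation E ϖ ^ n) (hN : valuation E ((q : 𝒪[E]) : E) = valuation E ϖ ^ N)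
    (hq : Nat.card 𝓀[E] = Nat.card 𝓀[F] ^ 2) (hξ : IsUnit (ξ - σO ξ)) (hNn : 1 ≤ N + n) :
    (Units.map ((Polynomial.eval₂RingHom (RingHom.prod (RingHom.id 𝒪[E]) j) ((u, lam) : 𝒪[E] × O₁)).range.subtype :
        (Polynomial.eval₂RingHom (RingHom.prod (RingHom.id 𝒪[E]) j) ((u, lam) : 𝒪[E] × O₁)).range →* 𝒪[E] × O₁)).range.relIndex
      (RingHom.eqLocus (RingHom.prodMap σO σ₁) (RingHom.id (𝒪[E] × O₁))).toSubmonoid.units = (Nat.card 𝓀[F] - 1) * Nat.card 𝓀[F] ^ (N + n - 1) := by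
  set R := (Polynomial.eval₂RingHom (RingHom.prod (RingHom.id 𝒪[E]) j) ((u, lam) : 𝒪[E] × O₁)).range with hR
  set Ψ₀ := RingHom.prodMap ιO (RingHom.eqLocus σ₁ (RingHom.id O₁)).subtype with hΨ₀
  set R₀ := R.comap Ψ₀ with hR₀
  set B₀ := RingHom.eqLocus (RingHom.prodMap σO σ₁) (RingHom.id (𝒪[E] × O₁)) with hB₀
  set V := (Units.map (R.subtype : R →* 𝒪[E] × O₁)).range with hV
  set Φ₀ : (𝒪[F] × RingHom.eqLocus σ₁ (RingHom.id O₁))ˣ →* (𝒪[E] × O₁)ˣ := Units.map (Ψ₀ : _ →* 𝒪[E] × O₁) with hΦ₀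
  have hinj := prodMap_subtype_injective ιO σ₁ hιinj
  -- `range Φ₀ = (Λ^⋆)^×`
  have hrange : Φ₀.range = B₀.toSubmonoid.units := by
    ext w
    rw [Submonoid.mem_units_iff, MonoidHom.mem_range]
    constructor
    · rintro ⟨w₀, rfl⟩
      refine ⟨(mem_eqLocus_prodMap_iff ιO σO σ₁ hσι hfixO _).2 ⟨(w₀ : 𝒪[F] × _), rfl⟩, (mem_eqLocus_prodMap_iff ιO σO σ₁ hσι hfixO _).2 ⟨(↑w₀⁻¹ : 𝒪[F] × _), ?_⟩⟩
      rw [hΦ₀, Units.coe_map_inv]; rfl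
    · rintro ⟨h1, h2⟩
      obtain ⟨p₁, hp₁⟩ := (mem_eqLocus_prodMap_iff ιO σO σ₁ hσι hfixO _).1 h1
      obtain ⟨p', hp'⟩ := (mem_eqLocus_prodMap_iff ιO σO σ₁ hσι hfixO _).1 h2
      have hpp : p₁ * p' = 1 := hinj (by rw [map_mul, map_one]; change Ψ₀ p₁ * Ψ₀ p' = 1; rw [hp₁, hp', Units.mul_inv])
      have hp'p : p' * p₁ = 1 := by rw [mul_comm]; exact hpp
      exact ⟨⟨p₁, p', hpp, hp'p⟩, Units.ext hp₁⟩
  -- `R^×` pulls back to `R^{⋆×}`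
  have hcomap : V.comap Φ₀ = (Units.map (R₀.subtype : R₀ →* 𝒪[F] × RingHom.eqLocus σ₁ (RingHom.id O₁))).range := by
    ext w₀
    rw [Subgroup.mem_comap, hV, mem_range_units_map_subtype_iff, mem_range_units_map_subtype_iff, hΦ₀, Units.coe_map, Units.coe_map_inv]
    rfl
  have hidx := Subgroup.index_comap V Φ₀
  rw [hrange, hcomap, index_units_comap_fixed_eq_eisenstein ιO σO j σ₁ θ u hσσ hσι hfixO hιinj hιu hσ₁j hσ₁θ hθ haF hk₀ hcoord hlam hlam2 hu1 hp1 hχ1 hxstar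
    hϖF hϖ hιϖ hn hN hq hξ hNn] at hidx
  exact hidx.symm

/-! ## §4 The type-(2) unit index `[C : R^×]` -/

/-- **THE TYPE-(2) UNIT INDEX, EISENSTEIN SHAPE: `[C : R^×] = (q + 1) · q^{N+n−1}`.**  `Λ = 𝒪_E × O₁` (`θ² = jaθ + jk₀`, `a, k₀ ∈ ιO𝔪_F`) with `⋆ = (σO, σ₁)`, `R = 𝒪_E[(u, λ)]`,
`λ = jp + jqθ` (`λ² − tλ + D = 0`, `(u,λ)(u,λ)⋆ = 1`, `u ≡ p ≡ 1`, `χ(1) ≡ 0`, `ord χ(u) = n`, **`ord q = N`**, `N + n ≥ 1`), `N(c) = c·c⋆` on `Λ^×` and `C := N⁻¹(R^×)`: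
**`[C : R^×] = (q + 1) q^{N+n−1}`**, `q = #𝓀_F` — ★ `relIndex_comap_norm_mul_relIndex_eq_index` with `[Λ^× : R^×] = (q² − 1) q^{2(N+n−1)}` ((L2′), `q_E = q²`) and `[(Λ^⋆)^× : R^{⋆×}] =
(q − 1) q^{N+n−1}` (§3).  At a WILD unit-discriminant type-(2) row (`O₁ = 𝒪[K₁]` on the Eisenstein uniformiser `Π = (α−1)∕ϖ^k`, `λ₁ = e₂(t + yα)`, `q = e₂yϖ^k`) this is the count of
self-dual `δ`-cyclic lattices with **`N = N_tame + k − ord_v 2`** (memo 4adf46b3 §4 (c)-consumer row).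
[cite: Rogawski1990, §4.9 Lemma 4.9.3 p. 56, Prop. 4.9.1 (b) p. 55] [cite: SerreLocalFields1979, Ch. V §2 Prop. 3] [cite: Jacobowitz1962, §7] -/
theorem relIndex_units_comap_norm_eq_eisenstein [Finite 𝓀[F]] [Finite 𝓀[E]] [IsDiscreteValuationRing 𝒪[E]] (hσσ : ∀ x, σO (σO x) = x) (hσι : ∀ y, σO (ιO y) = ιO y)
    (hfixO : ∀ x, σO x = x → ∃ y, ιO y = x) (hιinj : Function.Injective ιO) (hιu : ∀ y, IsUnit (ιO y) → IsUnit y)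
    (hσ₁j : ∀ x, σ₁ (j x) = j (σO x)) (hσ₁θ : σ₁ θ = θ)
    (hθ : θ ^ 2 = j (ιO aF) * θ + j (ιO k₀F)) (haF : aF ∈ IsLocalRing.maximalIdeal 𝒪[F]) (hk₀ : k₀F ∈ IsLocalRing.maximalIdeal 𝒪[F])
    (hcoord : ∀ z : O₁, ∃! bc : 𝒪[E] × 𝒪[E], z = j bc.1 + j bc.2 * θ) (hlam : lam = j p + j q * θ) (hlam2 : lam ^ 2 - j t * lam + j D = 0)
    (hu1 : u - 1 ∈ IsLocalRing.maximalIdeal 𝒪[E]) (hp1 : p - 1 ∈ IsLocalRing.maximalIdeal 𝒪[E]) (hχ1 : 1 - t + D ∈ IsLocalRing.maximalIdeal 𝒪[E])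
    (hxstar : ((u, lam) : 𝒪[E] × O₁) * RingHom.prodMap σO σ₁ (u, lam) = 1)
    (hnormE : ∀ b : 𝒪[E], IsUnit b → σO b = b → ∃ c : 𝒪[E], c * σO c = b) (hnorm₁ : ∀ z : O₁, IsUnit z → σ₁ z = z → ∃ w : O₁, w * σ₁ w = z)
    (hϖF : IsUniformizingElement ϖF) (hϖ : IsUniformizingElement ϖ) (hιϖ : ιO ⟨ϖF, hϖF.mem⟩ = ⟨ϖ, hϖ.mem⟩)
    (hn : valuation E ((u * u - t * u + D : 𝒪[E]) : E) = valuation E ϖ ^ n) (hN : valuation E ((q : 𝒪[E]) : E) = valuation E ϖ ^ N)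
    (hq : Nat.card 𝓀[E] = Nat.card 𝓀[F] ^ 2) (hξ : IsUnit (ξ - σO ξ)) (hNn : 1 ≤ N + n) :
    (Units.map ((Polynomial.eval₂RingHom (RingHom.prod (RingHom.id 𝒪[E]) j) ((u, lam) : 𝒪[E] × O₁)).range.subtype :
        (Polynomial.eval₂RingHom (RingHom.prod (RingHom.id 𝒪[E]) j) ((u, lam) : 𝒪[E] × O₁)).range →* 𝒪[E] × O₁)).range.relIndex
      ((Units.map ((Polynomial.eval₂RingHom (RingHom.prod (RingHom.id 𝒪[E]) j) ((u, lam) : 𝒪[E] × O₁)).range.subtype :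
        (Polynomial.eval₂RingHom (RingHom.prod (RingHom.id 𝒪[E]) j) ((u, lam) : 𝒪[E] × O₁)).range →* 𝒪[E] × O₁)).range.comap
        (MonoidHom.id (𝒪[E] × O₁)ˣ * Units.map (RingHom.prodMap σO σ₁ : 𝒪[E] × O₁ →* 𝒪[E] × O₁))) =
      (Nat.card 𝓀[F] + 1) * Nat.card 𝓀[F] ^ (N + n - 1) := by
  set R := (Polynomial.eval₂RingHom (RingHom.prod (RingHom.id 𝒪[E]) j) ((u, lam) : 𝒪[E] × O₁)).range with hR
  set V := (Units.map (R.subtype : R →* 𝒪[E] × O₁)).range with hV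
  set Nm := MonoidHom.id (𝒪[E] × O₁)ˣ * Units.map (RingHom.prodMap σO σ₁ : 𝒪[E] × O₁ →* 𝒪[E] × O₁) with hNm
  have ha : ιO aF ∈ IsLocalRing.maximalIdeal 𝒪[E] := map_k₀_mem_maximalIdeal ιO hιu haF
  have hk : ιO k₀F ∈ IsLocalRing.maximalIdeal 𝒪[E] := map_k₀_mem_maximalIdeal ιO hιu hk₀
  have hq1 : 1 < Nat.card 𝓀[F] := Finite.one_lt_card
  -- `N(V) ⊆ V`
  have hNval : ∀ v : (𝒪[E] × O₁)ˣ, ((Nm v : (𝒪[E] × O₁)ˣ) : 𝒪[E] × O₁) = (v : 𝒪[E] × O₁) * RingHom.prodMap σO σ₁ v := fun v => by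
    rw [hNm, MonoidHom.mul_apply, Units.val_mul, MonoidHom.id_apply, Units.coe_map]; rfl
  have hVN : V ≤ V.comap Nm := by
    intro v hv
    rw [Subgroup.mem_comap, hV, mem_range_units_map_subtype_iff, ← map_inv, hNval, hNval]
    rw [hV, mem_range_units_map_subtype_iff] at hv
    exact ⟨R.mul_mem hv.1 (star_mem_range_eval₂_eisenstein ιO σO j σ₁ θ u hιu hσ₁j hθ haF hk₀ hcoord hlam2 hxstar hv.1),
      R.mul_mem hv.2 (star_mem_range_eval₂_eisenstein ιO σO j σ₁ θ u hιu hσ₁j hθ haF hk₀ hcoord hlam2 hxstar hv.2)⟩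
  have key := relIndex_comap_norm_mul_relIndex_eq_index (RingHom.prodMap σO σ₁) V hVN
  rw [range_norm_eq σO j σ₁ θ hσσ hσ₁j hσ₁θ hcoord hnormE hnorm₁,
    relIndex_units_fixed_eq_eisenstein ιO σO j σ₁ θ u hσσ hσι hfixO hιinj hιu hσ₁j hσ₁θ hθ haF hk₀ hcoord hlam hlam2 hu1 hp1 hχ1 hxstar hϖF hϖ hιϖ hn hN hq hξ hNn,
    hV, index_units_range_eval₂_eq_eisenstein j θ u hθ ha hk hcoord hlam hlam2 hu1 hp1 hχ1 hϖ hn hN hNn, hq] at key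
  -- arithmetic: `X · (q−1) q^m = (q²−1) (q²)^m`, `m = N + n − 1`
  set m := N + n - 1 with hm
  obtain ⟨p₁, hp₁⟩ : ∃ p₁, Nat.card 𝓀[F] = p₁ + 1 := ⟨Nat.card 𝓀[F] - 1, by omega⟩
  rw [hp₁] at key ⊢
  simp only [Nat.add_sub_cancel] at key ⊢
  have hp0 : 0 < p₁ := by omega
  have hpos : 0 < p₁ * (p₁ + 1) ^ m := Nat.mul_pos hp0 (pow_pos (Nat.succ_pos p₁) _)
  refine Nat.eq_of_mul_eq_mul_right hpos ?_
  rw [key]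
  have e1 : (p₁ + 1) ^ 2 - 1 = p₁ * (p₁ + 2) := by
    have : (p₁ + 1) ^ 2 = p₁ * (p₁ + 2) + 1 := by ring
    omega
  rw [e1, ← pow_mul]
  ring

end Literature.NumberTheory.Automorphic

end
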